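import Summits.AnomalousDissipation.AnomalousDissipation.Theorems.ScalarAnomalySteadySourceFormal.Negative.ShearRepr

/-!
# Negative knowledge for the crux `ScalarAnomalySteadySourceFormal` (stmt-AnomalousDissipation-0448), VII-c:
# the band energy inequality — interior transport cancels, only boundary flux and source remain

Certified copy of §9.3 of the cdisprove work file.  For a finite set of modes `𝔅` and a
trigonometric-polynomial stirring field with TRANSVERSAL coefficients (`k · c_k = 0`, i.e. each mode
is divergence free), the transport pairing `∑_{p∈𝔅} N_p(Y) conj Y_p` has real part equal to that of
`πi · bdryFlux` (`re_sum_transportMode_mul_conj`): the interior interactions `p, p ∓ k ∈ 𝔅` cancel in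
conjugate pairs (the involution `(p,k,+) ↦ (p-k,k,-)`, `sum_interior_conj`).  Feeding this and
`two_inner_modeRHS` into the band energy identity of `Negative.ShearRepr` gives the
**band dissipation inequality** (`band_dissipation_le`): for every `T > 0`,
`2ν ∫₀ᵀ ∑_{p∈𝔅} 4π²|p|² ‖ỹ_p‖² ≤ ∑_{p∈𝔅} ‖𝓕θ₀(p)‖² + 2π ∫₀ᵀ ‖bdryFlux‖ + 2 ∫₀ᵀ ‖∑_{p∈𝔅} 𝓕h(p) conj ỹ_p‖`.

Supports stmt-AnomalousDissipation-0448 (the shear–drift no-go, files `Shear*`).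
-/

set_option linter.dupNamespace false

noncomputable section

open scoped BigOperators Topology ENNReal NNReal InnerProductSpace ContDiff
open Filter Set Function MeasureTheory UnitAddTorus Complex

namespace Summit.AnomalousDissipation.AnomalousDissipation.Theorems.ScalarAnomalySteadySourceFormal.Negative

open Literature.Analysis
open Literature.Analysis.FunctionSpaces Literature.Analysis.FunctionSpaces.Torus
open Literature.Analysis.FluidPDE Literature.Analysis.FluidPDE.Torus

variable {d : Type*} [Fintype d]

section Algebra

/-- `p · w = ∑ⱼ pⱼ wⱼ` for a frequency `p` and a complex vector `w`. [folklore] -/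
def zdot (p : d → ℤ) (w : EuclideanSpace ℂ d) : ℂ := ∑ j, (p j : ℂ) * w j

/-- Additivity of `zdot` in the frequency. [folklore] -/
theorem zdot_sub (p k : d → ℤ) (w : EuclideanSpace ℂ d) : zdot (p - k) w = zdot p w - zdot k w := by
  simp only [zdot, Pi.sub_apply, Int.cast_sub, sub_mul, Finset.sum_sub_distrib]

/-- Conjugation of `zdot`. [folklore] -/
theorem conj_zdot (p : d → ℤ) (w : EuclideanSpace ℂ d) :
    (starRingEnd ℂ) (zdot p w) = zdot p (EuclideanSpace.conjVec w) := by
  simp only [zdot, map_sum, map_mul, map_intCast, EuclideanSpace.conjVec_apply]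

/-- The transport symbol through `zdot`. [folklore] -/
theorem transportMode_eq_zdot (S : Finset (d → ℤ)) (cc : (d → ℤ) → EuclideanSpace ℂ d) (Y : (d → ℤ) → ℂ) (p : d → ℤ) :
    transportMode S cc Y p =
      Real.pi * I * ∑ k ∈ S, (zdot p (cc k) * Y (p - k) + zdot p (EuclideanSpace.conjVec (cc k)) * Y (p + k)) := by
  simp only [transportMode, zdot, EuclideanSpace.conjVec_apply]

/-- **The boundary flux** of the finite mode set `𝔅`: the transport interactions of `p ∈ 𝔅` with
neighbours `p ∓ k ∉ 𝔅`. [folklore] -/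
def bdryFlux (S 𝔅 : Finset (d → ℤ)) (cc : (d → ℤ) → EuclideanSpace ℂ d) (Y : (d → ℤ) → ℂ) : ℂ :=
  ∑ p ∈ 𝔅, ∑ k ∈ S, ((if p - k ∈ 𝔅 then 0 else zdot p (cc k) * Y (p - k) * (starRingEnd ℂ) (Y p)) +
    (if p + k ∈ 𝔅 then 0 else zdot p (EuclideanSpace.conjVec (cc k)) * Y (p + k) * (starRingEnd ℂ) (Y p)))

/-- **Interior cancellation**: with transversal coefficients, the interior `-` interactions are the
conjugates of the interior `+` interactions (reindex `p ↦ p + k`). [folklore] -/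
theorem sum_interior_conj [DecidableEq d] (S 𝔅 : Finset (d → ℤ)) (cc : (d → ℤ) → EuclideanSpace ℂ d) (Y : (d → ℤ) → ℂ)
    (htrans : ∀ k ∈ S, zdot k (cc k) = 0) :
    ∑ p ∈ 𝔅, ∑ k ∈ S, (if p + k ∈ 𝔅 then zdot p (EuclideanSpace.conjVec (cc k)) * Y (p + k) * (starRingEnd ℂ) (Y p) else 0) =
      (starRingEnd ℂ) (∑ p ∈ 𝔅, ∑ k ∈ S,
        (if p - k ∈ 𝔅 then zdot p (cc k) * Y (p - k) * (starRingEnd ℂ) (Y p) else 0)) := by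
  rw [map_sum, Finset.sum_comm]
  conv_rhs => rw [Finset.sum_congr rfl (fun p _ => map_sum (starRingEnd ℂ) _ S), Finset.sum_comm]
  refine Finset.sum_congr rfl fun k hk => ?_
  rw [← Finset.sum_filter]
  conv_rhs => rw [Finset.sum_congr rfl (fun p _ => apply_ite (starRingEnd ℂ) _ _ _), map_zero, ← Finset.sum_filter]
  refine Finset.sum_nbij' (fun p => p + k) (fun p => p - k) (fun p hp => ?_) (fun p hp => ?_)
    (fun p _ => by simp) (fun p _ => by simp) (fun p hp => ?_)
  · simp only [Finset.mem_filter] at hp ⊢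
    exact ⟨hp.2, by simpa using hp.1⟩
  · simp only [Finset.mem_filter] at hp ⊢
    exact ⟨hp.2, by simpa using hp.1⟩
  · have h0 : zdot k (EuclideanSpace.conjVec (cc k)) = 0 := by
      rw [← conj_zdot, htrans k hk, map_zero]
    have e : zdot p (EuclideanSpace.conjVec (cc k)) = zdot (p + k) (EuclideanSpace.conjVec (cc k)) := by
      rw [show p = p + k - k by simp, zdot_sub, h0, sub_zero]; simp
    rw [map_mul, map_mul, conj_zdot, Complex.conj_conj, e, add_sub_cancel_right]
    ring

/-- **Real part of the transport pairing = real part of `πi ·` boundary flux.** [folklore] -/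
theorem re_sum_transportMode_mul_conj [DecidableEq d] (S 𝔅 : Finset (d → ℤ)) (cc : (d → ℤ) → EuclideanSpace ℂ d)
    (Y : (d → ℤ) → ℂ) (htrans : ∀ k ∈ S, zdot k (cc k) = 0) :
    (∑ p ∈ 𝔅, transportMode S cc Y p * (starRingEnd ℂ) (Y p)).re = (Real.pi * I * bdryFlux S 𝔅 cc Y).re := by
  set A : (d → ℤ) → (d → ℤ) → ℂ := fun p k => zdot p (cc k) * Y (p - k) * (starRingEnd ℂ) (Y p) with hA
  set B : (d → ℤ) → (d → ℤ) → ℂ := fun p k =>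
    zdot p (EuclideanSpace.conjVec (cc k)) * Y (p + k) * (starRingEnd ℂ) (Y p) with hB
  set IntA : ℂ := ∑ p ∈ 𝔅, ∑ k ∈ S, (if p - k ∈ 𝔅 then A p k else 0) with hIntA
  set IntB : ℂ := ∑ p ∈ 𝔅, ∑ k ∈ S, (if p + k ∈ 𝔅 then B p k else 0) with hIntB
  have hsplit : ∑ p ∈ 𝔅, transportMode S cc Y p * (starRingEnd ℂ) (Y p) =
      Real.pi * I * (IntA + IntB + bdryFlux S 𝔅 cc Y) := by
    have e1 : ∀ p ∈ 𝔅, transportMode S cc Y p * (starRingEnd ℂ) (Y p) =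
        Real.pi * I * ∑ k ∈ S, (A p k + B p k) := by
      intro p _
      rw [transportMode_eq_zdot, mul_assoc, Finset.sum_mul]
      congr 1
      refine Finset.sum_congr rfl fun k _ => ?_
      simp only [hA, hB]
      ring
    rw [Finset.sum_congr rfl e1, ← Finset.mul_sum]
    congr 1
    simp only [hIntA, hIntB, bdryFlux, ← Finset.sum_add_distrib]
    refine Finset.sum_congr rfl fun p _ => Finset.sum_congr rfl fun k _ => ?_
    simp only [hA, hB]
    split_ifs <;> ring
  have hconj : IntB = (starRingEnd ℂ) IntA := sum_interior_conj S 𝔅 cc Y htrans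
  rw [hsplit, hconj, mul_add, Complex.add_re]
  have hreal : (Real.pi * I * (IntA + (starRingEnd ℂ) IntA)).re = 0 := by
    rw [Complex.add_conj]
    simp [Complex.mul_re, Complex.mul_im]
  rw [hreal, zero_add]

/-- The pairing of the modes of a real `h` with `Y` over `𝔅`: `∑_{p∈𝔅} 𝓕h(p) conj Y_p`. [folklore] -/
def sourcePairing (𝔅 : Finset (d → ℤ)) (h : UnitAddTorus d → ℝ) (Y : (d → ℤ) → ℂ) : ℂ :=
  ∑ p ∈ 𝔅, mFourierCoeff (fun x => (h x : ℂ)) p * (starRingEnd ℂ) (Y p)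

/-- The (real) spectral dissipation density of `Y` over `𝔅`: `∑_{p∈𝔅} 4π²|p|² ‖Y_p‖²`. [folklore] -/
def bandDiss (𝔅 : Finset (d → ℤ)) (Y : (d → ℤ) → ℂ) : ℝ :=
  ∑ p ∈ 𝔅, 4 * Real.pi ^ 2 * freqNormSq p * ‖Y p‖ ^ 2

omit [Fintype d] in
/-- `bandDiss ≥ 0`. [folklore] -/
theorem bandDiss_nonneg [Fintype d] (𝔅 : Finset (d → ℤ)) (Y : (d → ℤ) → ℂ) : 0 ≤ bandDiss 𝔅 Y :=
  Finset.sum_nonneg fun p _ => by have := freqNormSq_nonneg p; positivity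

/-- **The band integrand, expanded**: with transversal coefficients,
`∑_{p∈𝔅} 2⟪Y_p, modeRHS_p⟫ = -2ν bandDiss - 2 Re(πi bdryFlux) + 2 Re(sourcePairing)`. [folklore] -/
theorem sum_two_inner_modeRHS [DecidableEq d] {ν : ℝ} (S 𝔅 : Finset (d → ℤ)) {c : ℝ → (d → ℤ) → EuclideanSpace ℂ d}
    (h : UnitAddTorus d → ℝ) (Y : ℝ → (d → ℤ) → ℂ) (s : ℝ) (htrans : ∀ k ∈ S, zdot k (c s k) = 0) :
    ∑ p ∈ 𝔅, 2 * ⟪Y s p, modeRHS ν S c h Y p s⟫_ℝ =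
      -2 * ν * bandDiss 𝔅 (Y s) - 2 * (Real.pi * I * bdryFlux S 𝔅 (c s) (Y s)).re +
        2 * (sourcePairing 𝔅 h (Y s)).re := by
  have e : ∀ p ∈ 𝔅, 2 * ⟪Y s p, modeRHS ν S c h Y p s⟫_ℝ =
      -2 * (4 * Real.pi ^ 2 * ν * freqNormSq p) * ‖Y s p‖ ^ 2 -
        2 * (transportMode S (c s) (Y s) p * (starRingEnd ℂ) (Y s p)).re +
        2 * (mFourierCoeff (fun x => (h x : ℂ)) p * (starRingEnd ℂ) (Y s p)).re := fun p _ =>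
    two_inner_modeRHS _ _ _ _
  rw [Finset.sum_congr rfl e]
  have hN : ∑ p ∈ 𝔅, 2 * (transportMode S (c s) (Y s) p * (starRingEnd ℂ) (Y s p)).re =
      2 * (Real.pi * I * bdryFlux S 𝔅 (c s) (Y s)).re := by
    rw [← Finset.mul_sum, ← Complex.re_sum, re_sum_transportMode_mul_conj S 𝔅 (c s) (Y s) htrans]
  have hH : ∑ p ∈ 𝔅, 2 * (mFourierCoeff (fun x => (h x : ℂ)) p * (starRingEnd ℂ) (Y s p)).re =
      2 * (sourcePairing 𝔅 h (Y s)).re := by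
    rw [← Finset.mul_sum, ← Complex.re_sum]
    rfl
  have hDd : ∑ p ∈ 𝔅, -2 * (4 * Real.pi ^ 2 * ν * freqNormSq p) * ‖Y s p‖ ^ 2 = -2 * ν * bandDiss 𝔅 (Y s) := by
    rw [bandDiss, Finset.mul_sum]
    exact Finset.sum_congr rfl fun p _ => by ring
  rw [Finset.sum_add_distrib, Finset.sum_sub_distrib, hN, hH, hDd]

end Algebra

section Band

variable {ν : ℝ} {S : Finset (d → ℤ)} {c : ℝ → (d → ℤ) → EuclideanSpace ℂ d}
  {u : ℝ → UnitAddTorus d → EuclideanSpace ℝ d} {h θ₀ : UnitAddTorus d → ℝ} {θ : ℝ → UnitAddTorus d → ℝ}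

/-- Continuity of the boundary flux along the representatives. [folklore] -/
theorem continuousOn_bdryFlux (hw : IsWeakScalarTransportForced ν u (fun _ => h) θ₀ θ)
    (hc : ∀ k, Continuous fun s => c s k) {M : ℝ} (hM : ∀ s k, ‖c s k‖ ≤ M) {T : ℝ} (hT : 0 < T)
    (𝔅 : Finset (d → ℤ)) :
    ContinuousOn (fun t => bdryFlux S 𝔅 (c t) (cmodes ν S c h θ₀ θ t)) (Icc 0 T) := by
  classical
  have hY : ∀ q, ContinuousOn (fun s => cmodes ν S c h θ₀ θ s q) (Icc 0 T) :=
    fun q => continuousOn_cmodes hw hc hM hT q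
  have hz : ∀ (p : d → ℤ) (w : ℝ → EuclideanSpace ℂ d), (∀ j, Continuous fun s => w s j) →
      Continuous fun s => zdot p (w s) := fun p w hw' =>
    continuous_finsetSum _ fun j _ => continuous_const.mul (hw' j)
  have hcj : ∀ k j, Continuous fun s => c s k j := fun k j => (EuclideanSpace.proj j).continuous.comp (hc k)
  have hcj' : ∀ k j, Continuous fun s => EuclideanSpace.conjVec (c s k) j := fun k j => by
    simp only [EuclideanSpace.conjVec_apply]; exact Complex.continuous_conj.comp (hcj k j)
  unfold bdryFlux
  refine continuousOn_finsetSum _ fun p _ => continuousOn_finsetSum _ fun k _ => ContinuousOn.add ?_ ?_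
  · split_ifs
    · exact continuousOn_const
    · exact (((hz p _ (hcj k)).continuousOn.mul (hY (p - k))).mul ((hY p).star))
  · split_ifs
    · exact continuousOn_const
    · exact (((hz p _ (hcj' k)).continuousOn.mul (hY (p + k))).mul ((hY p).star))

/-- Continuity of the source pairing along the representatives. [folklore] -/
theorem continuousOn_sourcePairing (hw : IsWeakScalarTransportForced ν u (fun _ => h) θ₀ θ)
    (hc : ∀ k, Continuous fun s => c s k) {M : ℝ} (hM : ∀ s k, ‖c s k‖ ≤ M) {T : ℝ} (hT : 0 < T)
    (𝔅 : Finset (d → ℤ)) :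
    ContinuousOn (fun t => sourcePairing 𝔅 h (cmodes ν S c h θ₀ θ t)) (Icc 0 T) := by
  unfold sourcePairing
  exact continuousOn_finsetSum _ fun p _ => continuousOn_const.mul (continuousOn_cmodes hw hc hM hT p).star

/-- Continuity of the band dissipation density along the representatives. [folklore] -/
theorem continuousOn_bandDiss (hw : IsWeakScalarTransportForced ν u (fun _ => h) θ₀ θ)
    (hc : ∀ k, Continuous fun s => c s k) {M : ℝ} (hM : ∀ s k, ‖c s k‖ ≤ M) {T : ℝ} (hT : 0 < T)
    (𝔅 : Finset (d → ℤ)) :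
    ContinuousOn (fun t => bandDiss 𝔅 (cmodes ν S c h θ₀ θ t)) (Icc 0 T) := by
  unfold bandDiss
  exact continuousOn_finsetSum _ fun p _ => continuousOn_const.mul (((continuousOn_cmodes hw hc hM hT p).norm).pow 2)

/-- **The band dissipation inequality.**  For every finite set of modes `𝔅` and every `T > 0`,
`2ν ∫₀ᵀ ∑_{p∈𝔅} 4π²|p|² ‖ỹ_p‖² ≤ ∑_{p∈𝔅} ‖𝓕θ₀(p)‖² + 2π ∫₀ᵀ ‖bdryFlux‖ + 2 ∫₀ᵀ ‖sourcePairing‖`: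
the interior transport does no work on the band. [folklore] -/
theorem band_dissipation_le [DecidableEq d] (hw : IsWeakScalarTransportForced ν u (fun _ => h) θ₀ θ)
    (hu : ∀ s, u s = realTrigPoly S (c s)) (hh : Integrable h volume) (hθ₀ : Integrable θ₀ volume)
    (hc : ∀ k, Continuous fun s => c s k) {M : ℝ} (hM : ∀ s k, ‖c s k‖ ≤ M)
    (htrans : ∀ s, ∀ k ∈ S, zdot k (c s k) = 0) {T : ℝ} (hT : 0 < T) (𝔅 : Finset (d → ℤ)) :
    2 * ν * ∫ t in (0 : ℝ)..T, bandDiss 𝔅 (cmodes ν S c h θ₀ θ t) ≤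
      bandEnergy 𝔅 (fun p => mFourierCoeff (fun x => (θ₀ x : ℂ)) p) +
        2 * Real.pi * (∫ t in (0 : ℝ)..T, ‖bdryFlux S 𝔅 (c t) (cmodes ν S c h θ₀ θ t)‖) +
        2 * ∫ t in (0 : ℝ)..T, ‖sourcePairing 𝔅 h (cmodes ν S c h θ₀ θ t)‖ := by
  have hid := bandEnergy_sub_eq_integral hw hu hh hθ₀ hc hM hT 𝔅
  have hpt : ∀ t, ∑ p ∈ 𝔅, 2 * ⟪cmodes ν S c h θ₀ θ t p, cmodeRHS ν S c h θ₀ θ p t⟫_ℝ =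
      -2 * ν * bandDiss 𝔅 (cmodes ν S c h θ₀ θ t) - 2 * (Real.pi * I * bdryFlux S 𝔅 (c t) (cmodes ν S c h θ₀ θ t)).re +
        2 * (sourcePairing 𝔅 h (cmodes ν S c h θ₀ θ t)).re := fun t =>
    sum_two_inner_modeRHS S 𝔅 h (cmodes ν S c h θ₀ θ) t (htrans t)
  simp_rw [hpt] at hid
  set Y := cmodes ν S c h θ₀ θ with hYdef
  have hD := continuousOn_bandDiss (S := S) hw hc hM hT 𝔅
  have hF := continuousOn_bdryFlux (S := S) hw hc hM hT 𝔅
  have hP := continuousOn_sourcePairing (S := S) hw hc hM hT 𝔅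
  have iD : IntervalIntegrable (fun t => bandDiss 𝔅 (Y t)) volume 0 T := hD.intervalIntegrable_of_Icc hT.le
  have iF : IntervalIntegrable (fun t => (Real.pi * I * bdryFlux S 𝔅 (c t) (Y t)).re) volume 0 T :=
    (Complex.continuous_re.comp_continuousOn (continuousOn_const.mul hF)).intervalIntegrable_of_Icc hT.le
  have iP : IntervalIntegrable (fun t => (sourcePairing 𝔅 h (Y t)).re) volume 0 T :=
    (Complex.continuous_re.comp_continuousOn hP).intervalIntegrable_of_Icc hT.le
  rw [intervalIntegral.integral_add ((iD.const_mul _).sub (iF.const_mul _)) (iP.const_mul _),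
    intervalIntegral.integral_sub (iD.const_mul _) (iF.const_mul _),
    intervalIntegral.integral_const_mul, intervalIntegral.integral_const_mul, intervalIntegral.integral_const_mul] at hid
  have hE0 : bandEnergy 𝔅 (Y 0) = bandEnergy 𝔅 (fun p => mFourierCoeff (fun x => (θ₀ x : ℂ)) p) := by
    simp only [bandEnergy, hYdef, cmodes_zero]
  have hET : 0 ≤ bandEnergy 𝔅 (Y T) := bandEnergy_nonneg _ _
  -- bounds on the two signed integrals
  have hF' : |∫ t in (0 : ℝ)..T, (Real.pi * I * bdryFlux S 𝔅 (c t) (Y t)).re| ≤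
      Real.pi * ∫ t in (0 : ℝ)..T, ‖bdryFlux S 𝔅 (c t) (Y t)‖ := by
    rw [← intervalIntegral.integral_const_mul]
    refine (intervalIntegral.abs_integral_le_integral_abs hT.le).trans
      (intervalIntegral.integral_mono_on hT.le iF.abs ((hF.norm).intervalIntegrable_of_Icc hT.le |>.const_mul _)
        fun t _ => ?_)
    refine (Complex.abs_re_le_norm _).trans ?_
    rw [norm_mul, norm_mul, Complex.norm_real, Complex.norm_I, mul_one, Real.norm_eq_abs, abs_of_pos Real.pi_pos]
  have hP' : |∫ t in (0 : ℝ)..T, (sourcePairing 𝔅 h (Y t)).re| ≤ ∫ t in (0 : ℝ)..T, ‖sourcePairing 𝔅 h (Y t)‖ := by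
    refine (intervalIntegral.abs_integral_le_integral_abs hT.le).trans
      (intervalIntegral.integral_mono_on hT.le iP.abs ((hP.norm).intervalIntegrable_of_Icc hT.le) fun t _ => ?_)
    exact Complex.abs_re_le_norm _
  have h1 := (abs_le.1 hF').1
  have h2 := (abs_le.1 hP').2
  rw [hE0] at hid
  linarith [hid, hET, h1, h2]

end Band

end Summit.AnomalousDissipation.AnomalousDissipation.Theorems.ScalarAnomalySteadySourceFormal.Negative
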